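import Summits.ValiantsHypothesis.ValiantsHypothesis.Theorems.LacunarySymmetroidMatrixDescartesVLawCoreClosed
import Summits.ValiantsHypothesis.ValiantsHypothesis.Theorems.LacunarySymmetroidMatrixDescartesFanLawTwo

/-!
# `MatrixDescartes` (stmt-ValiantsHypothesis-18050), line `Lift` — the CLOSED-WINDOW FAN LAW
# (boundary gaps `γ = −1` and `γ = 2` admitted when the boundary letter is positive definite)

HONEST FRAMING.  Cell `pub-symmetroid`, seat `val-sym-mdr-p2` (gen 3); helper `--supports` the crux
`Theses.LacunarySymmetroid.MatrixDescartes`, NO closure claim.  Extends gen 2's wide fan law (`…FanLawTwo.lean`, open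
window `γ ∈ (−1,0) ∪ (1,2)`) to the closed window; this is the desk's first wake item for the mdr successor (R1414 (α):
«boundary gaps γ ∈ {−1, 1, 2} — provable variant: boundary letters positive DEFINITE»).  Nothing here bears on
`stub_twoSided` in general, the crux in its window, `DoorA26`/`DoorA34`, or `VP ≠ VNP`.

**CLOSED-WINDOW FAN LAW** (`fanLawThree_lower`, mirror `fanLawThree_upper`).  `F(X) = X^e J + ∑ k, X^{d k} P k`, `J` real
symmetric, all `P k ⪰ 0`, a FACTORING letter `k₀` with gap `a = |d k₀ − e| > 0`, and every other letter `k` in one of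
four classes: (Q) opposite side of the pivot with gap `< a`; (B) opposite side with gap EXACTLY `a` and `P k ≻ 0`;
(R) same side as `k₀` with gap strictly between `a` and `2a`; (E) same side with gap EXACTLY `2a` and `P k ≻ 0`.  Then
`det F` has at most `2 · card ι` distinct positive zeros — every `κ`, every `ι`.  In signed gap ratios
`γ = β_k/β_{k₀}` this is the CLOSED kernel-positivity window `γ ∈ [−1, 0) ∪ (1, 2]` (the point `γ = 1` = a second
letter at the factoring exponent is cosmetic: merge it into the factoring letter), with positive definiteness asked
only of letters sitting exactly on the boundary.  Examples newly covered: `(e − a | e | e + a, e + b)` with `b < a`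
and the gap-`a` upper letter definite; `(e − 2a, e − a | e | e + b)` (`b < a`, the gap-`2a` letter definite).  What
stays OPEN at the boundary: boundary letters that are merely semidefinite with NO definite companion at all (the
point-mass blocks give nonnegativity but per-node nondegeneracy does not give strictness — gen 2's census).
PROOF.  If no letter sits on the boundary this is `FanLawTwo.fanLawTwo_lower`.  Otherwise the boundary letter is
positive definite and the chain argument of `…FanLaw.lean` runs with `VLawCoreClosed.core_pos₄`, whose strictness
input is exactly the linear independence of the earlier kernel vectors that `VLawChain.linearIndependent_of_chain`
supplies at each step.  [folklore] given the companion files.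
-/

-- layout Summits/ValiantsHypothesis/ValiantsHypothesis forces the duplicated namespace component
set_option linter.dupNamespace false

namespace Summit.ValiantsHypothesis.ValiantsHypothesis.Theorems.LacunarySymmetroidMatrixDescartes

open Polynomial Matrix Finset
open scoped BigOperators

namespace FanLawThree

variable {ι : Type} [Fintype ι] [DecidableEq ι] {κ : Type} [Fintype κ] [DecidableEq κ]

omit [Fintype ι] [DecidableEq ι] in
/-- H-form of a closed lower fan at `t ≠ 0`: factoring letter `k₀` below the pivot (gap `a = e − d k₀`), the other
letters split into the four classes (Q) above/open, (R) below/open, (B) above at gap `a`, (E) below at gap `2a`.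
[folklore] -/
theorem pencil_eq_smul_hform₄ (e : ℕ) (d : κ → ℕ) (J : Matrix ι ι ℝ) (P : κ → Matrix ι ι ℝ) (k₀ : κ)
    (hlow : d k₀ ≤ e)
    (hB : ∀ k, k ≠ k₀ → e < d k → ¬ d k - e < e - d k₀ → d k = e + (e - d k₀))
    (hE : ∀ k, k ≠ k₀ → ¬ e < d k → ¬ e - d k < 2 * (e - d k₀) → d k + 2 * (e - d k₀) = e)
    {t : ℝ} (ht : t ≠ 0) :
    t ^ e • J + ∑ k, t ^ d k • P k
      = t ^ e • (J + (t ^ (e - d k₀))⁻¹ • P k₀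
          + ∑ l : {k // (k ≠ k₀ ∧ e < d k) ∧ d k - e < e - d k₀}, t ^ (d l.1 - e) • P l.1
          + ∑ m : {k // (k ≠ k₀ ∧ ¬ e < d k) ∧ e - d k < 2 * (e - d k₀)}, (t ^ (e - d m.1))⁻¹ • P m.1
          + ∑ p : {k // (k ≠ k₀ ∧ e < d k) ∧ ¬ d k - e < e - d k₀}, t ^ (e - d k₀) • P p.1
          + ∑ r : {k // (k ≠ k₀ ∧ ¬ e < d k) ∧ ¬ e - d k < 2 * (e - d k₀)},
              ((t ^ (e - d k₀)) ^ 2)⁻¹ • P r.1) := by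
  classical
  have hsplit : ∑ k, t ^ d k • P k = t ^ d k₀ • P k₀
      + ((∑ k ∈ ((Finset.univ.erase k₀).filter (fun k => e < d k)).filter (fun k => d k - e < e - d k₀),
            t ^ d k • P k
        + ∑ k ∈ ((Finset.univ.erase k₀).filter (fun k => e < d k)).filter (fun k => ¬ d k - e < e - d k₀),
            t ^ d k • P k)
      + (∑ k ∈ ((Finset.univ.erase k₀).filter (fun k => ¬ e < d k)).filter (fun k => e - d k < 2 * (e - d k₀)),
            t ^ d k • P k
        + ∑ k ∈ ((Finset.univ.erase k₀).filter (fun k => ¬ e < d k)).filter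
            (fun k => ¬ e - d k < 2 * (e - d k₀)), t ^ d k • P k)) := by
    rw [← Finset.add_sum_erase _ _ (Finset.mem_univ k₀),
      ← Finset.sum_filter_add_sum_filter_not (Finset.univ.erase k₀) (fun k => e < d k),
      ← Finset.sum_filter_add_sum_filter_not ((Finset.univ.erase k₀).filter (fun k => e < d k))
        (fun k => d k - e < e - d k₀),
      ← Finset.sum_filter_add_sum_filter_not ((Finset.univ.erase k₀).filter (fun k => ¬ e < d k))
        (fun k => e - d k < 2 * (e - d k₀))]
  have hQ : ∑ k ∈ ((Finset.univ.erase k₀).filter (fun k => e < d k)).filter (fun k => d k - e < e - d k₀),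
        t ^ d k • P k
      = t ^ e • ∑ l : {k // (k ≠ k₀ ∧ e < d k) ∧ d k - e < e - d k₀}, t ^ (d l.1 - e) • P l.1 := by
    rw [Finset.sum_subtype (((Finset.univ.erase k₀).filter (fun k => e < d k)).filter
        (fun k => d k - e < e - d k₀)) (p := fun k => (k ≠ k₀ ∧ e < d k) ∧ d k - e < e - d k₀)
        (fun k => by simp [Finset.mem_erase, Finset.mem_filter]), Finset.smul_sum]
    refine Finset.sum_congr rfl fun l _ => ?_
    rw [smul_smul, ← pow_add, show e + (d l.1 - e) = d l.1 by have := l.2.1.2; omega]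
  have hBsum : ∑ k ∈ ((Finset.univ.erase k₀).filter (fun k => e < d k)).filter (fun k => ¬ d k - e < e - d k₀),
        t ^ d k • P k
      = t ^ e • ∑ p : {k // (k ≠ k₀ ∧ e < d k) ∧ ¬ d k - e < e - d k₀}, t ^ (e - d k₀) • P p.1 := by
    rw [Finset.sum_subtype (((Finset.univ.erase k₀).filter (fun k => e < d k)).filter
        (fun k => ¬ d k - e < e - d k₀)) (p := fun k => (k ≠ k₀ ∧ e < d k) ∧ ¬ d k - e < e - d k₀)
        (fun k => by simp [Finset.mem_erase, Finset.mem_filter]), Finset.smul_sum]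
    refine Finset.sum_congr rfl fun p _ => ?_
    rw [smul_smul, ← pow_add, ← hB p.1 p.2.1.1 p.2.1.2 p.2.2]
  have hR : ∑ k ∈ ((Finset.univ.erase k₀).filter (fun k => ¬ e < d k)).filter (fun k => e - d k < 2 * (e - d k₀)),
        t ^ d k • P k
      = t ^ e • ∑ m : {k // (k ≠ k₀ ∧ ¬ e < d k) ∧ e - d k < 2 * (e - d k₀)}, (t ^ (e - d m.1))⁻¹ • P m.1 := by
    rw [Finset.sum_subtype (((Finset.univ.erase k₀).filter (fun k => ¬ e < d k)).filter
        (fun k => e - d k < 2 * (e - d k₀))) (p := fun k => (k ≠ k₀ ∧ ¬ e < d k) ∧ e - d k < 2 * (e - d k₀))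
        (fun k => by simp [Finset.mem_erase, Finset.mem_filter]), Finset.smul_sum]
    refine Finset.sum_congr rfl fun m _ => ?_
    rw [smul_smul, ← pow_sub₀ t ht (Nat.sub_le e (d m.1)),
      show e - (e - d m.1) = d m.1 by have := m.2.1.2; omega]
  have hEsum : ∑ k ∈ ((Finset.univ.erase k₀).filter (fun k => ¬ e < d k)).filter
        (fun k => ¬ e - d k < 2 * (e - d k₀)), t ^ d k • P k
      = t ^ e • ∑ r : {k // (k ≠ k₀ ∧ ¬ e < d k) ∧ ¬ e - d k < 2 * (e - d k₀)},
          ((t ^ (e - d k₀)) ^ 2)⁻¹ • P r.1 := by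
    rw [Finset.sum_subtype (((Finset.univ.erase k₀).filter (fun k => ¬ e < d k)).filter
        (fun k => ¬ e - d k < 2 * (e - d k₀)))
        (p := fun k => (k ≠ k₀ ∧ ¬ e < d k) ∧ ¬ e - d k < 2 * (e - d k₀))
        (fun k => by simp [Finset.mem_erase, Finset.mem_filter]), Finset.smul_sum]
    refine Finset.sum_congr rfl fun r _ => ?_
    have hr := hE r.1 r.2.1.1 r.2.1.2 r.2.2
    rw [smul_smul, ← pow_mul, ← pow_sub₀ t ht (show (e - d k₀) * 2 ≤ e by omega),
      show e - (e - d k₀) * 2 = d r.1 by omega]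
  have hP0 : t ^ d k₀ • P k₀ = t ^ e • ((t ^ (e - d k₀))⁻¹ • P k₀) := by
    rw [smul_smul, ← pow_sub₀ t ht (Nat.sub_le e (d k₀)), show e - (e - d k₀) = d k₀ by omega]
  rw [hsplit, hQ, hBsum, hR, hEsum, hP0]
  simp only [smul_add]
  abel

/-- **Closed-window lower fan law.**  Factoring letter `k₀` below the pivot, gap `a = e − d k₀`; every other letter is
above the pivot with gap `< a`, or above with gap `= a` and positive definite, or below with gap in `(a, 2a)`, or below
with gap `= 2a` and positive definite ⇒ `Z₊ ≤ 2 · card ι`. [folklore] -/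
theorem fanLawThree_lower (e : ℕ) (d : κ → ℕ) (J : Matrix ι ι ℝ) (P : κ → Matrix ι ι ℝ) (k₀ : κ)
    (hJ : J.IsSymm) (hP : ∀ k, (P k).PosSemidef) (hlow : d k₀ < e)
    (hfan : ∀ k, k ≠ k₀ → (e < d k ∧ d k - e < e - d k₀)
      ∨ (d k = e + (e - d k₀) ∧ (P k).PosDef)
      ∨ (d k < e ∧ e - d k₀ < e - d k ∧ e - d k < 2 * (e - d k₀))
      ∨ (d k + 2 * (e - d k₀) = e ∧ (P k).PosDef)) :
    ((Matrix.det (((Polynomial.X : Polynomial ℝ) ^ e) • J.map Polynomial.C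
        + ∑ k, ((Polynomial.X : Polynomial ℝ) ^ d k) • (P k).map Polynomial.C)).roots.toFinset.filter
          (fun t => 0 < t)).card ≤ 2 * Fintype.card ι := by
  classical
  -- no boundary letter: the wide fan law
  by_cases hbd : ∃ k, k ≠ k₀ ∧ (d k = e + (e - d k₀) ∨ d k + 2 * (e - d k₀) = e)
  swap
  · push Not at hbd
    refine FanLawTwo.fanLawTwo_lower e d J P k₀ hJ hP hlow fun k hk => ?_
    rcases hfan k hk with h | ⟨h, _⟩ | h | ⟨h, _⟩
    · exact Or.inl h
    · exact absurd h (hbd k hk).1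
    · exact Or.inr h
    · exact absurd h (hbd k hk).2
  obtain ⟨k₁, hk₁, hk₁bd⟩ := hbd
  set p := Matrix.det (((Polynomial.X : Polynomial ℝ) ^ e) • J.map Polynomial.C
        + ∑ k, ((Polynomial.X : Polynomial ℝ) ^ d k) • (P k).map Polynomial.C) with hp
  by_cases hdet : p = 0
  · simp [hdet]
  -- the four classes
  have hB : ∀ k, k ≠ k₀ → e < d k → ¬ d k - e < e - d k₀ → d k = e + (e - d k₀) := by
    intro k hk h1 h2
    rcases hfan k hk with h | ⟨h, _⟩ | h | ⟨h, _⟩ <;> omega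
  have hE : ∀ k, k ≠ k₀ → ¬ e < d k → ¬ e - d k < 2 * (e - d k₀) → d k + 2 * (e - d k₀) = e := by
    intro k hk h1 h2
    rcases hfan k hk with h | ⟨h, _⟩ | h | ⟨h, _⟩ <;> omega
  have hRopen : ∀ m : {k // (k ≠ k₀ ∧ ¬ e < d k) ∧ e - d k < 2 * (e - d k₀)},
      d m.1 < e ∧ e - d k₀ < e - d m.1 ∧ e - d m.1 < 2 * (e - d k₀) := fun m => by
    rcases hfan m.1 m.2.1.1 with h | ⟨h, _⟩ | h | ⟨h, _⟩
    · exact absurd h.1 m.2.1.2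
    · exfalso; have := m.2.1.2; omega
    · exact h
    · exfalso; have := m.2.2; have h2 := m.2.1.2; omega
  have hBpd : ∀ q : {k // (k ≠ k₀ ∧ e < d k) ∧ ¬ d k - e < e - d k₀}, (P q.1).PosDef := fun q => by
    rcases hfan q.1 q.2.1.1 with h | ⟨_, h⟩ | h | ⟨_, h⟩
    · exact absurd h.2 q.2.2
    · exact h
    · exact absurd h.1 (by have := q.2.1.2; omega)
    · exact h
  have hEpd : ∀ r : {k // (k ≠ k₀ ∧ ¬ e < d k) ∧ ¬ e - d k < 2 * (e - d k₀)}, (P r.1).PosDef := fun r => by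
    rcases hfan r.1 r.2.1.1 with h | ⟨_, h⟩ | h | ⟨_, h⟩
    · exact absurd h.1 r.2.1.2
    · exact h
    · exact absurd h.2.2 r.2.2
    · exact h
  -- the H-form data
  set a : ℕ := e - d k₀ with ha_def
  have ha : 0 < a := by omega
  set b : {k // (k ≠ k₀ ∧ e < d k) ∧ d k - e < e - d k₀} → ℕ := fun l => d l.1 - e with hb_def
  set n : {k // (k ≠ k₀ ∧ e < d k) ∧ d k - e < e - d k₀} → ℕ := fun l => a - 1 - b l with hn_def
  have hb : ∀ l, 0 < b l := fun l => by have := l.2.1.2; simp only [hb_def]; omega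
  have hnb : ∀ l, n l + b l + 1 = a := fun l => by
    have := l.2.2; simp only [hn_def, hb_def, ha_def] at this ⊢; omega
  set c : {k // (k ≠ k₀ ∧ ¬ e < d k) ∧ e - d k < 2 * (e - d k₀)} → ℕ := fun m => e - d m.1 with hc_def
  set b' : {k // (k ≠ k₀ ∧ ¬ e < d k) ∧ e - d k < 2 * (e - d k₀)} → ℕ := fun m => 2 * a - c m with hb'_def
  set n' : {k // (k ≠ k₀ ∧ ¬ e < d k) ∧ e - d k < 2 * (e - d k₀)} → ℕ := fun m => a - 1 - b' m with hn'_def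
  have hb' : ∀ m, 0 < b' m := fun m => by
    have := hRopen m; simp only [hb'_def, hc_def, ha_def] at this ⊢; omega
  have hcb : ∀ m, c m + b' m = 2 * a := fun m => by
    have := hRopen m; simp only [hb'_def, hc_def, ha_def] at this ⊢; omega
  have hnb' : ∀ m, n' m + b' m + 1 = a := fun m => by
    have := hRopen m; simp only [hn'_def, hb'_def, hc_def, ha_def] at this ⊢; omega
  set Q : {k // (k ≠ k₀ ∧ e < d k) ∧ d k - e < e - d k₀} → Matrix ι ι ℝ := fun l => P l.1 with hQ_def
  set R : {k // (k ≠ k₀ ∧ ¬ e < d k) ∧ e - d k < 2 * (e - d k₀)} → Matrix ι ι ℝ := fun m => P m.1 with hR_def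
  set B : {k // (k ≠ k₀ ∧ e < d k) ∧ ¬ d k - e < e - d k₀} → Matrix ι ι ℝ := fun q => P q.1 with hB_def
  set E : {k // (k ≠ k₀ ∧ ¬ e < d k) ∧ ¬ e - d k < 2 * (e - d k₀)} → Matrix ι ι ℝ := fun r => P r.1
    with hE_def
  have hQ : ∀ l, (Q l).PosSemidef := fun l => hP l.1
  have hR : ∀ m, (R m).PosSemidef := fun m => hP m.1
  have hBpsd : ∀ q, (B q).PosSemidef := fun q => hP q.1
  have hEpsd : ∀ r, (E r).PosSemidef := fun r => hP r.1
  -- the positive definite companion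
  have hPD : (∃ l, (Q l).PosDef) ∨ (∃ m, (R m).PosDef) ∨ (∃ q, (B q).PosDef) ∨ (∃ r, (E r).PosDef) := by
    rcases hk₁bd with h | h
    · exact Or.inr (Or.inr (Or.inl ⟨⟨k₁, ⟨hk₁, by omega⟩, by omega⟩, hBpd _⟩))
    · exact Or.inr (Or.inr (Or.inr ⟨⟨k₁, ⟨hk₁, by omega⟩, by omega⟩, hEpd _⟩))
  set G : ℝ → Matrix ι ι ℝ := fun t => t ^ e • J + ∑ k, t ^ d k • P k with hG
  set H : ℝ → Matrix ι ι ℝ := fun t =>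
    J + (t ^ a)⁻¹ • P k₀ + ∑ l, t ^ (b l) • Q l + ∑ m, (t ^ (c m))⁻¹ • R m
      + ∑ q, t ^ a • B q + ∑ r, ((t ^ a) ^ 2)⁻¹ • E r with hH
  have hGH : ∀ t : ℝ, t ≠ 0 → G t = t ^ e • H t := fun t ht =>
    pencil_eq_smul_hform₄ e d J P k₀ hlow.le hB hE ht
  set Rt := p.roots.toFinset.filter (fun t => 0 < t) with hRt
  have hroot : ∀ t ∈ Rt, 0 < t ∧ Matrix.det (G t) = 0 := by
    intro t ht
    have h1 := (Finset.mem_filter.1 ht)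
    rw [Multiset.mem_toFinset, Polynomial.mem_roots hdet, Polynomial.IsRoot.def, hp,
      StubReverse.eval_det_pencil] at h1
    exact ⟨h1.2, h1.1⟩
  have hkerH : ∀ t : ℝ, 0 < t → ∀ v : ι → ℝ, G t *ᵥ v = 0 → H t *ᵥ v = 0 := by
    intro t ht v hv
    rw [hGH t ht.ne', smul_mulVec, smul_eq_zero] at hv
    exact hv.resolve_left (pow_ne_zero e ht.ne')
  -- slope of the Rayleigh quotient at a node
  set σ : ℝ → (ι → ℝ) → ℝ := fun t v =>
    -((a : ℝ) * (t ^ a)⁻¹ * (v ⬝ᵥ (P k₀ *ᵥ v))) + ∑ l, (b l : ℝ) * t ^ (b l) * (v ⬝ᵥ (Q l *ᵥ v))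
      - ∑ m, (c m : ℝ) * (t ^ (c m))⁻¹ * (v ⬝ᵥ (R m *ᵥ v))
      + ∑ q, (a : ℝ) * t ^ a * (v ⬝ᵥ (B q *ᵥ v))
      - ∑ r, (2 * a : ℝ) * ((t ^ a) ^ 2)⁻¹ * (v ⬝ᵥ (E r *ᵥ v)) with hσ
  set TA : ℝ → Prop := fun t => ∃ v : ι → ℝ, v ≠ 0 ∧ G t *ᵥ v = 0 ∧ 0 ≤ σ t v with hTA
  set TD : ℝ → Prop := fun t => ∃ v : ι → ℝ, v ≠ 0 ∧ G t *ᵥ v = 0 ∧ σ t v ≤ 0 with hTD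
  have hcover : Rt ⊆ Rt.filter TA ∪ Rt.filter TD := by
    intro t ht
    obtain ⟨v, hv, hGv⟩ := Matrix.exists_mulVec_eq_zero_iff.2 (hroot t ht).2
    rcases le_total 0 (σ t v) with h | h
    · exact Finset.mem_union.2 (Or.inl (Finset.mem_filter.2 ⟨ht, v, hv, hGv, h⟩))
    · exact Finset.mem_union.2 (Or.inr (Finset.mem_filter.2 ⟨ht, v, hv, hGv, h⟩))
  -- the closed-window STAR core lemma, specialised
  have hcore : ∀ (mm : ℕ) (u : Fin mm → ℝ) (w : Fin mm → ι → ℝ), (∀ j, 0 < u j) → Function.Injective u →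
      LinearIndependent ℝ w → (∀ j, G (u j) *ᵥ w j = 0) → ∀ s : ℝ, 0 < s → (∀ j, s ≠ u j) →
      (∀ j, 0 ≤ (s - u j) * σ (u j) (w j)) → ∀ cc : Fin mm → ℝ, cc ≠ 0 →
      0 < (∑ j, cc j • w j) ⬝ᵥ (G s *ᵥ ∑ j, cc j • w j) := by
    intro mm u w hu huinj hwli hker s hs hsu hstar cc hcc
    have h := VLawCoreClosed.core_pos₄ a ha b n hnb hb c n' b' hnb' hb' hcb J (P k₀) Q R B E hJ (hP k₀) hQ hR
      hBpsd hEpsd u hu huinj w hwli (fun j => hkerH _ (hu j) _ (hker j)) s hs hsu hstar hPD cc hcc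
    rw [hGH s hs.ne', smul_mulVec, dotProduct_smul, smul_eq_mul]
    exact mul_pos (pow_pos hs e) h
  -- ascending zeros: at most `card ι`
  have hcardA : (Rt.filter TA).card ≤ Fintype.card ι := by
    set RA := Rt.filter TA with hRA
    let τ : Fin RA.card ↪o ℝ := RA.orderEmbOfFin rfl
    have hτmem : ∀ j, τ j ∈ RA := fun j => RA.orderEmbOfFin_mem rfl j
    have hτA : ∀ j, TA (τ j) := fun j => (Finset.mem_filter.1 (hτmem j)).2
    have hτpos : ∀ j, 0 < τ j := fun j => (hroot _ (Finset.mem_filter.1 (hτmem j)).1).1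
    choose v hv0 hker htyp using hτA
    have hli : LinearIndependent ℝ v :=
      VLawChain.linearIndependent_of_chain G τ v hv0 hker fun j hj hpre cc hcc =>
        hcore j (fun i => τ (Fin.castLE hj.le i)) (fun i => v (Fin.castLE hj.le i))
          (fun i => hτpos _)
          (fun i i' h => Fin.castLE_injective hj.le (τ.injective h))
          hpre (fun i => hker _) (τ ⟨j, hj⟩) (hτpos _)
          (fun i => (τ.strictMono (show Fin.castLE hj.le i < ⟨j, hj⟩ from i.2)).ne')
          (fun i => mul_nonneg (sub_nonneg.2
            (τ.strictMono (show Fin.castLE hj.le i < ⟨j, hj⟩ from i.2)).le) (htyp _)) cc hcc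
    have h := hli.fintype_card_le_finrank
    rwa [Fintype.card_fin, Module.finrank_fintype_fun_eq_card] at h
  -- descending zeros: at most `card ι`
  have hcardD : (Rt.filter TD).card ≤ Fintype.card ι := by
    set RD := Rt.filter TD with hRD
    let τ₀ : Fin RD.card ↪o ℝ := RD.orderEmbOfFin rfl
    set τ : Fin RD.card → ℝ := fun j => τ₀ (Fin.rev j) with hτ
    have hτanti : StrictAnti τ := fun i i' h => τ₀.strictMono (Fin.rev_lt_rev.2 h)
    have hτmem : ∀ j, τ j ∈ RD := fun j => RD.orderEmbOfFin_mem rfl (Fin.rev j)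
    have hτD : ∀ j, TD (τ j) := fun j => (Finset.mem_filter.1 (hτmem j)).2
    have hτpos : ∀ j, 0 < τ j := fun j => (hroot _ (Finset.mem_filter.1 (hτmem j)).1).1
    choose v hv0 hker htyp using hτD
    have hli : LinearIndependent ℝ v :=
      VLawChain.linearIndependent_of_chain G τ v hv0 hker fun j hj hpre cc hcc =>
        hcore j (fun i => τ (Fin.castLE hj.le i)) (fun i => v (Fin.castLE hj.le i))
          (fun i => hτpos _)
          (fun i i' h => Fin.castLE_injective hj.le (hτanti.injective h))
          hpre (fun i => hker _) (τ ⟨j, hj⟩) (hτpos _)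
          (fun i => (hτanti (show Fin.castLE hj.le i < ⟨j, hj⟩ from i.2)).ne)
          (fun i => mul_nonneg_of_nonpos_of_nonpos (sub_nonpos.2
            (hτanti (show Fin.castLE hj.le i < ⟨j, hj⟩ from i.2)).le) (htyp _)) cc hcc
    have h := hli.fintype_card_le_finrank
    rwa [Fintype.card_fin, Module.finrank_fintype_fun_eq_card] at h
  calc Rt.card ≤ (Rt.filter TA ∪ Rt.filter TD).card := Finset.card_le_card hcover
    _ ≤ (Rt.filter TA).card + (Rt.filter TD).card := Finset.card_union_le _ _
    _ ≤ Fintype.card ι + Fintype.card ι := Nat.add_le_add hcardA hcardD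
    _ = 2 * Fintype.card ι := by ring

/-- **Closed-window upper fan law** (mirror, via `stub_reverse`): factoring letter `k₀` above the pivot, gap
`a = d k₀ − e`; every other letter below with gap `< a`, or below with gap `= a` and positive definite, or above with
gap in `(a, 2a)`, or above with gap `= 2a` and positive definite. [folklore] -/
theorem fanLawThree_upper (e : ℕ) (d : κ → ℕ) (J : Matrix ι ι ℝ) (P : κ → Matrix ι ι ℝ) (k₀ : κ)
    (hJ : J.IsSymm) (hP : ∀ k, (P k).PosSemidef) (hup : e < d k₀)
    (hfan : ∀ k, k ≠ k₀ → (d k < e ∧ e - d k < d k₀ - e)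
      ∨ (d k + (d k₀ - e) = e ∧ (P k).PosDef)
      ∨ (e < d k ∧ d k₀ - e < d k - e ∧ d k - e < 2 * (d k₀ - e))
      ∨ (d k = e + 2 * (d k₀ - e) ∧ (P k).PosDef)) :
    ((Matrix.det (((Polynomial.X : Polynomial ℝ) ^ e) • J.map Polynomial.C
        + ∑ k, ((Polynomial.X : Polynomial ℝ) ^ d k) • (P k).map Polynomial.C)).roots.toFinset.filter
          (fun t => 0 < t)).card ≤ 2 * Fintype.card ι := by
  -- reflect at `N = 2 · d k₀` (an upper bound for every exponent)
  have hd : ∀ k, d k ≤ 2 * d k₀ := by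
    intro k
    by_cases hk : k = k₀
    · rw [hk]; omega
    · rcases hfan k hk with h | ⟨h, _⟩ | h | ⟨h, _⟩ <;> omega
  rw [stub_reverse ι κ e (2 * d k₀) d J P (by omega) hd]
  refine fanLawThree_lower (2 * d k₀ - e) (fun k => 2 * d k₀ - d k) J P k₀ hJ hP
    (show 2 * d k₀ - d k₀ < 2 * d k₀ - e by omega) fun k hk => ?_
  rcases hfan k hk with h | ⟨h, hpd⟩ | h | ⟨h, hpd⟩
  · left
    show 2 * d k₀ - e < 2 * d k₀ - d k ∧ 2 * d k₀ - d k - (2 * d k₀ - e) < 2 * d k₀ - e - (2 * d k₀ - d k₀)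
    omega
  · right; left
    refine ⟨?_, hpd⟩
    show 2 * d k₀ - d k = 2 * d k₀ - e + (2 * d k₀ - e - (2 * d k₀ - d k₀))
    omega
  · right; right; left
    show 2 * d k₀ - d k < 2 * d k₀ - e ∧ 2 * d k₀ - e - (2 * d k₀ - d k₀) < 2 * d k₀ - e - (2 * d k₀ - d k)
      ∧ 2 * d k₀ - e - (2 * d k₀ - d k) < 2 * (2 * d k₀ - e - (2 * d k₀ - d k₀))
    omega
  · right; right; right
    refine ⟨?_, hpd⟩
    show 2 * d k₀ - d k + 2 * (2 * d k₀ - e - (2 * d k₀ - d k₀)) = 2 * d k₀ - e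
    have := hd k
    omega

end FanLawThree

end Summit.ValiantsHypothesis.ValiantsHypothesis.Theorems.LacunarySymmetroidMatrixDescartes
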